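import Summits.Parity.GeneralizedHardyLittlewood.Theorems.LeeYangFibresRelativeDimOneFloatingSiegelDefs
import Literature.NumberTheory.Sieve.MoebiusShiftedPrimesProofs
import Mathlib.NumberTheory.Primorial
import Mathlib.Analysis.Complex.ExponentialBounds
import HarnessLib

/-!
# Route `LeeYangFibres`, crux `RelativeDimOne` (stmt-Parity-14113), line `floating-level-core`:
# the registered stub `stub_pairMassTransfer` — two moduli with the same small prime divisors have the
# same normalised pair-sum lattice mass

`PairSumModel → PairMassTransfer` (vocabulary `LeeYangFibresRelativeDimOneFloatingSiegelDefs`): if the pair sums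
`S_N(h) = Σ_{n ≤ N − h} Λ(n)Λ(n + h)` are `(N − h) g(h) ± ε(N h/φ(h) + N)` for a function `g` of the prime divisors
`p ≤ w = wlev D N` of `h`, bounded by `C(w + 1)`, then two moduli `m₁, m₂ ≤ N^{1/4}` with the same prime divisors
`p ≤ w` have the same normalised lattice mass `m · pairMass N m/N²`, `pairMass N m = 2 Σ_{k ≤ N/m} S_N(mk)`, up to
`δ(m₁/φ(m₁) + m₂/φ(m₂))`, eventually in `N` (`D ≥ 4`).

Proof (elementary; no primes beyond the model). The sequence `γ(k) = g(k m₁) = g(k m₂)` is periodic modulo the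
primorial `P` of `w` and `|γ| ≤ M = C(w + 1)`. For one modulus `m`: summing the model over `h = mk`, `k ≤ Y = N/m`
(`Σ_{k ≤ Y} mk/φ(mk) ≤ e (m/φ(m)) Y`, super-multiplicativity of `φ` and `Lichtman2020.sum_div_totient_le`), Abel
summation (`GallagherBackwards.sum_linearWeight_eq_abel`) against the centred periodic sequence `γ − mean(γ)`
(partial sums `≤ 2MP`), and `0 ≤ N² − 2m Σ_{k ≤ Y}(N − mk) ≤ mN` give
`|m · pairMass N m/N² − mean(γ)| ≤ 5 M P m/N + 8ε m/φ(m)` (`pmt_single_modulus`). Finally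
`(w + 1) P ≤ 16^w` (`primorial_le_four_pow`), `16^{2w} ≤ 4^{wD} ≤ N`, so `5 M P m ≤ 5 C N^{3/4} ≤ (δ/2) N` for
`N ≥ (10C/δ)^4`, and `ε = δ/16`.

References: Gallagher, Mathematika 23 (1976) §2 [Gallagher1976] (the identity behind `pairMass`); the averaging
argument is folklore.
-/

noncomputable section

open scoped BigOperators Classical ArithmeticFunction.vonMangoldt
open Finset Filter Literature.NumberTheory.Sieve
open Summit.Parity.GeneralizedHardyLittlewood.Cruxes.RelativeDimOne.GallagherBackwards (classPsi charPsi)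
open Summit.Parity.GeneralizedHardyLittlewood.Cruxes.RelativeDimOne.GallagherBackwardsSplit
open Summit.Parity.GeneralizedHardyLittlewood.Cruxes.RelativeDimOne.TypeSplit

namespace Summit.Parity.GeneralizedHardyLittlewood.Cruxes.RelativeDimOne.FloatingLevelCore

/-! ### Periodic sequences with zero period-sum: bounded partial sums, Abel summation -/

/-- A `P`-periodic sequence with vanishing sum over a period has `P`-periodic partial sums. -/
theorem pmt_partialSum_add_period {c : ℕ → ℝ} {P : ℕ} (hper : ∀ k, c (k + P) = c k)
    (hsum : ∑ k ∈ Icc 1 P, c k = 0) (j : ℕ) :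
    ∑ k ∈ Icc 1 (j + P), c k = ∑ k ∈ Icc 1 j, c k := by
  induction j with
  | zero => simp [hsum]
  | succ j ih =>
    rw [show j + 1 + P = (j + P) + 1 by ring, Finset.sum_Icc_succ_top (by omega), ih,
      Finset.sum_Icc_succ_top (by omega), show j + P + 1 = (j + 1) + P by ring, hper]

/-- The partial sums of a `P`-periodic sequence with vanishing period-sum only depend on `j % P`. -/
theorem pmt_partialSum_eq_mod {c : ℕ → ℝ} {P : ℕ} (hper : ∀ k, c (k + P) = c k)
    (hsum : ∑ k ∈ Icc 1 P, c k = 0) (j : ℕ) :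
    ∑ k ∈ Icc 1 j, c k = ∑ k ∈ Icc 1 (j % P), c k := by
  have key : ∀ q r : ℕ, ∑ k ∈ Icc 1 (r + P * q), c k = ∑ k ∈ Icc 1 r, c k := by
    intro q
    induction q with
    | zero => intro r; simp
    | succ q ih =>
      intro r
      rw [show r + P * (q + 1) = (r + P * q) + P by ring, pmt_partialSum_add_period hper hsum, ih]
  conv_lhs => rw [← Nat.mod_add_div j P]
  exact key (j / P) (j % P)

/-- Bounded partial sums: `|Σ_{k ≤ j} c k| ≤ B P` for a `P`-periodic `c` with zero period-sum and `|c| ≤ B`. -/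
theorem pmt_abs_partialSum_le {c : ℕ → ℝ} {P : ℕ} {B : ℝ} (hP : 0 < P) (hper : ∀ k, c (k + P) = c k)
    (hsum : ∑ k ∈ Icc 1 P, c k = 0) (hB : ∀ k, |c k| ≤ B) (j : ℕ) :
    |∑ k ∈ Icc 1 j, c k| ≤ B * P := by
  rw [pmt_partialSum_eq_mod hper hsum j]
  have hB0 : 0 ≤ B := (abs_nonneg _).trans (hB 0)
  calc |∑ k ∈ Icc 1 (j % P), c k| ≤ ∑ k ∈ Icc 1 (j % P), |c k| := Finset.abs_sum_le_sum_abs _ _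
    _ ≤ ∑ k ∈ Icc 1 (j % P), B := Finset.sum_le_sum fun k _ => hB k
    _ = ((j % P : ℕ) : ℝ) * B := by simp
    _ ≤ (P : ℝ) * B := by gcongr; exact (Nat.mod_lt j hP).le
    _ = B * P := mul_comm _ _

/-- Abel summation against a `P`-periodic `c` with zero period-sum and `|c| ≤ B`:
`|Σ_{k ≤ K} (N − q k) c k| ≤ N B P` whenever `0 ≤ q`, `q K ≤ N`. -/
theorem pmt_abs_sum_linearWeight_le {c : ℕ → ℝ} {P : ℕ} {B : ℝ} (hP : 0 < P)
    (hper : ∀ k, c (k + P) = c k) (hsum : ∑ k ∈ Icc 1 P, c k = 0) (hB : ∀ k, |c k| ≤ B)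
    {N q : ℝ} (hq : 0 ≤ q) {K : ℕ} (hK : q * K ≤ N) :
    |∑ k ∈ Icc 1 K, (N - q * k) * c k| ≤ N * (B * P) := by
  rw [GallagherBackwards.sum_linearWeight_eq_abel]
  have hA := pmt_abs_partialSum_le hP hper hsum hB
  have h1 : |(N - q * K) * ∑ k ∈ Icc 1 K, c k| ≤ (N - q * K) * (B * P) := by
    rw [abs_mul, abs_of_nonneg (by linarith)]
    exact mul_le_mul_of_nonneg_left (hA K) (by linarith)
  have h2 : |q * ∑ j ∈ range K, ∑ k ∈ Icc 1 j, c k| ≤ q * (K * (B * P)) := by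
    rw [abs_mul, abs_of_nonneg hq]
    refine mul_le_mul_of_nonneg_left ?_ hq
    calc |∑ j ∈ range K, ∑ k ∈ Icc 1 j, c k| ≤ ∑ j ∈ range K, |∑ k ∈ Icc 1 j, c k| :=
          Finset.abs_sum_le_sum_abs _ _
      _ ≤ ∑ j ∈ range K, B * P := Finset.sum_le_sum fun j _ => hA j
      _ = K * (B * P) := by simp
  calc _ ≤ |(N - q * K) * ∑ k ∈ Icc 1 K, c k| + |q * ∑ j ∈ range K, ∑ k ∈ Icc 1 j, c k| :=
        abs_add_le _ _
    _ ≤ (N - q * K) * (B * P) + q * (K * (B * P)) := add_le_add h1 h2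
    _ = N * (B * P) := by ring

/-! ### The Fejér weight sum `Σ_{k ≤ N/m} (N − m k)` -/

/-- `2 Σ_{1 ≤ k ≤ Y} (N − q k) = Y (2N − q Y − q)`. -/
theorem pmt_two_mul_sum_linearWeight (N q : ℝ) (Y : ℕ) :
    2 * ∑ k ∈ Icc 1 Y, (N - q * k) = Y * (2 * N - q * Y - q) := by
  induction Y with
  | zero => simp
  | succ Y ih =>
    rw [Finset.sum_Icc_succ_top (by omega), mul_add, ih]
    push_cast
    ring

/-- With `Y = N / m` (`0 < m`): `0 ≤ N² − 2m Σ_{k ≤ Y} (N − m k) ≤ m N`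
(`N = mY + r`, `0 ≤ r < m`, and `N² − mY(2N − mY − m) = r² + m · mY`). -/
theorem pmt_weightSum_bounds {N m : ℕ} (hm : 0 < m) :
    0 ≤ (N : ℝ) ^ 2 - 2 * m * ∑ k ∈ Icc 1 (N / m), ((N : ℝ) - m * k) ∧
      (N : ℝ) ^ 2 - 2 * m * ∑ k ∈ Icc 1 (N / m), ((N : ℝ) - m * k) ≤ m * N := by
  have h2 := pmt_two_mul_sum_linearWeight (N : ℝ) m (N / m)
  have hN : (N : ℝ) = m * ((N / m : ℕ) : ℝ) + ((N % m : ℕ) : ℝ) := by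
    exact_mod_cast (Nat.div_add_mod N m).symm
  have hr0 : (0 : ℝ) ≤ ((N % m : ℕ) : ℝ) := Nat.cast_nonneg _
  have hrm : ((N % m : ℕ) : ℝ) ≤ m := by exact_mod_cast (Nat.mod_lt N hm).le
  have hY0 : (0 : ℝ) ≤ ((N / m : ℕ) : ℝ) := Nat.cast_nonneg _
  have hm0 : (0 : ℝ) ≤ m := Nat.cast_nonneg _
  set Y : ℝ := ((N / m : ℕ) : ℝ)
  set r : ℝ := ((N % m : ℕ) : ℝ)
  have hkey : (N : ℝ) ^ 2 - 2 * m * ∑ k ∈ Icc 1 (N / m), ((N : ℝ) - m * k) = r ^ 2 + m * (m * Y) := by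
    rw [show (2 : ℝ) * m * ∑ k ∈ Icc 1 (N / m), ((N : ℝ) - m * k) =
      m * (2 * ∑ k ∈ Icc 1 (N / m), ((N : ℝ) - m * k)) by ring, h2, hN]
    ring
  rw [hkey]
  have hrr : r * r ≤ r * m := mul_le_mul_of_nonneg_left hrm hr0
  constructor
  · positivity
  · rw [hN]
    nlinarith [hrr, mul_nonneg hm0 hY0]

/-! ### The totient weights along a lattice -/

/-- `1 ≤ m/φ(m)` for `0 < m`. -/
theorem pmt_one_le_div_totient {m : ℕ} (hm : 0 < m) : (1 : ℝ) ≤ (m : ℝ) / (Nat.totient m : ℝ) := by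
  rw [le_div_iff₀ (by exact_mod_cast Nat.totient_pos.mpr hm), one_mul]
  exact_mod_cast Nat.totient_le m

/-- `Σ_{1 ≤ k ≤ Y} (mk)/φ(mk) ≤ e · (m/φ(m)) · Y` (`φ` is super-multiplicative, and `Σ_{k ≤ Y} k/φ(k) ≤ e Y`,
`Lichtman2020.sum_div_totient_le`). -/
theorem pmt_sum_div_totient_mul_le {m : ℕ} (hm : 0 < m) (Y : ℕ) :
    ∑ k ∈ Icc 1 Y, ((m * k : ℕ) : ℝ) / (Nat.totient (m * k) : ℝ) ≤
      Real.exp 1 * ((m : ℝ) / (Nat.totient m : ℝ)) * Y := by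
  have hρ : 0 ≤ (m : ℝ) / (Nat.totient m : ℝ) := by positivity
  have hφm : (0 : ℝ) < Nat.totient m := by exact_mod_cast Nat.totient_pos.mpr hm
  calc ∑ k ∈ Icc 1 Y, ((m * k : ℕ) : ℝ) / (Nat.totient (m * k) : ℝ)
      ≤ ∑ k ∈ Icc 1 Y, (m : ℝ) / (Nat.totient m : ℝ) * ((k : ℝ) / (Nat.totient k : ℝ)) := by
        refine Finset.sum_le_sum fun k hk => ?_
        have hk : 0 < k := by have := (Finset.mem_Icc.mp hk).1; omega
        have hφk : (0 : ℝ) < Nat.totient k := by exact_mod_cast Nat.totient_pos.mpr hk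
        have hφmk : (0 : ℝ) < Nat.totient (m * k) := by
          exact_mod_cast Nat.totient_pos.mpr (Nat.mul_pos hm hk)
        have hsup : (Nat.totient m : ℝ) * Nat.totient k ≤ Nat.totient (m * k) := by
          exact_mod_cast Nat.totient_super_multiplicative m k
        rw [div_mul_div_comm, div_le_div_iff₀ hφmk (mul_pos hφm hφk)]
        push_cast
        exact mul_le_mul_of_nonneg_left hsup (by positivity)
    _ = (m : ℝ) / (Nat.totient m : ℝ) * ∑ k ∈ Icc 1 Y, (k : ℝ) / (Nat.totient k : ℝ) := by
        rw [Finset.mul_sum]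
    _ ≤ (m : ℝ) / (Nat.totient m : ℝ) * (Real.exp 1 * Y) :=
        mul_le_mul_of_nonneg_left (Lichtman2020.sum_div_totient_le Y) hρ
    _ = Real.exp 1 * ((m : ℝ) / (Nat.totient m : ℝ)) * Y := by ring

/-! ### The single-modulus estimate -/

/-- **Single modulus.** If `k ↦ g(mk)` is `P`-periodic and bounded by `M`, and `g` reproduces the pair sums
`S_N(h)` as `(N − h) g(h) ± ε(N h/φ(h) + N)` (`1 ≤ h ≤ N`), then the normalised lattice mass `m · pairMass N m/N²`
is the period-mean of `g(mk)` up to `5 M P m/N + 8 ε m/φ(m)` (sum over `h = mk`, `k ≤ N/m`; Abel summation against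
the centred periodic sequence; `Σ_{k ≤ N/m} (N − mk) = N²/(2m) + O(N)`). -/
theorem pmt_single_modulus {N m P : ℕ} {g : ℕ → ℝ} {M ε : ℝ} (hN : 0 < N) (hm : 0 < m) (hP : 0 < P)
    (hε : 0 ≤ ε) (hper : ∀ k, g (m * (k + P)) = g (m * k)) (hbd : ∀ k, |g (m * k)| ≤ M)
    (happ : ∀ h : ℕ, 1 ≤ h → h ≤ N →
      |(∑ n ∈ Icc 1 (N - h), Λ n * Λ (n + h)) - ((N - h : ℕ) : ℝ) * g h| ≤
        ε * N * ((h : ℝ) / (Nat.totient h : ℝ)) + ε * N) :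
    |(m : ℝ) * pairMass N m / (N : ℝ) ^ 2 - (∑ k ∈ Icc 1 P, g (m * k)) / P| ≤
      5 * M * P * m / N + 8 * ε * ((m : ℝ) / (Nat.totient m : ℝ)) := by
  set Y : ℕ := N / m with hY
  set ρ : ℝ := (m : ℝ) / (Nat.totient m : ℝ)
  set γb : ℝ := (∑ k ∈ Icc 1 P, g (m * k)) / P with hγb
  set W : ℝ := ∑ k ∈ Icc 1 Y, ((N : ℝ) - m * k) with hW
  have hM0 : 0 ≤ M := (abs_nonneg _).trans (hbd 0)
  have hNr : (0 : ℝ) < N := by exact_mod_cast hN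
  have hmr : (0 : ℝ) < m := by exact_mod_cast hm
  have hPr : (0 : ℝ) < P := by exact_mod_cast hP
  have hP1 : (1 : ℝ) ≤ P := by exact_mod_cast hP
  have hY0 : (0 : ℝ) ≤ Y := Nat.cast_nonneg _
  have hρ1 : 1 ≤ ρ := pmt_one_le_div_totient hm
  have hρ0 : 0 ≤ ρ := zero_le_one.trans hρ1
  have hmY : (m : ℝ) * Y ≤ N := by exact_mod_cast Nat.mul_div_le N m
  -- the period mean is bounded by `M`
  have hγbM : |γb| ≤ M := by
    rw [hγb, abs_div, abs_of_pos hPr, div_le_iff₀ hPr]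
    calc |∑ k ∈ Icc 1 P, g (m * k)| ≤ ∑ k ∈ Icc 1 P, |g (m * k)| := Finset.abs_sum_le_sum_abs _ _
      _ ≤ ∑ k ∈ Icc 1 P, M := Finset.sum_le_sum fun k _ => hbd k
      _ = M * P := by simp [mul_comm]
  -- the centred sequence `c k = g(mk) − γb`: periodic, zero period-sum, `|c| ≤ 2M`
  have hcper : ∀ k, g (m * (k + P)) - γb = g (m * k) - γb := fun k => by rw [hper]
  have hcsum : ∑ k ∈ Icc 1 P, (g (m * k) - γb) = 0 := by
    rw [Finset.sum_sub_distrib, Finset.sum_const, Nat.card_Icc, Nat.add_sub_cancel, nsmul_eq_mul, hγb,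
      mul_div_cancel₀ _ hPr.ne', sub_self]
  have hcB : ∀ k, |g (m * k) - γb| ≤ 2 * M := fun k =>
    (abs_sub _ _).trans (by linarith [hbd k, hγbM])
  -- (a) pointwise model → summed model
  set E : ℝ := (∑ k ∈ Icc 1 Y, ∑ n ∈ Icc 1 (N - m * k), Λ n * Λ (n + m * k)) -
    ∑ k ∈ Icc 1 Y, ((N - m * k : ℕ) : ℝ) * g (m * k) with hE
  have hEle : |E| ≤ 4 * ε * N * Y * ρ := by
    rw [hE, ← Finset.sum_sub_distrib]
    calc _ ≤ ∑ k ∈ Icc 1 Y, |(∑ n ∈ Icc 1 (N - m * k), Λ n * Λ (n + m * k)) -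
          ((N - m * k : ℕ) : ℝ) * g (m * k)| := Finset.abs_sum_le_sum_abs _ _
      _ ≤ ∑ k ∈ Icc 1 Y, (ε * N * (((m * k : ℕ) : ℝ) / (Nat.totient (m * k) : ℝ)) + ε * N) := by
          refine Finset.sum_le_sum fun k hk => ?_
          obtain ⟨hk1, hkY⟩ := Finset.mem_Icc.mp hk
          have hmk : m * k ≤ N := by rw [mul_comm]; exact (Nat.le_div_iff_mul_le hm).mp hkY
          exact_mod_cast happ (m * k) (Nat.mul_pos hm (by omega)) hmk
      _ = ε * N * (∑ k ∈ Icc 1 Y, ((m * k : ℕ) : ℝ) / (Nat.totient (m * k) : ℝ)) + ε * N * Y := by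
          rw [Finset.sum_add_distrib, Finset.mul_sum, Finset.sum_const, Nat.card_Icc, Nat.add_sub_cancel,
            nsmul_eq_mul]
          ring
      _ ≤ ε * N * (Real.exp 1 * ρ * Y) + ε * N * Y := by
          gcongr
          exact pmt_sum_div_totient_mul_le hm Y
      _ = ε * N * (Real.exp 1 * ρ * Y + Y) := by ring
      _ ≤ ε * N * (4 * Y * ρ) := by
          refine mul_le_mul_of_nonneg_left ?_ (by positivity)
          have h1 : Real.exp 1 * ρ * Y ≤ 3 * ρ * Y := by
            gcongr
            exact Real.exp_one_lt_three.le
          have h2 : (Y : ℝ) ≤ ρ * Y := le_mul_of_one_le_left hY0 hρ1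
          linarith
      _ = 4 * ε * N * Y * ρ := by ring
  -- (b) real weights, and the split `g(mk) = γb + c k`
  have hcast : ∑ k ∈ Icc 1 Y, ((N - m * k : ℕ) : ℝ) * g (m * k) =
      ∑ k ∈ Icc 1 Y, ((N : ℝ) - m * k) * g (m * k) := by
    refine Finset.sum_congr rfl fun k hk => ?_
    have hmk : m * k ≤ N := by rw [mul_comm]; exact (Nat.le_div_iff_mul_le hm).mp (Finset.mem_Icc.mp hk).2
    rw [Nat.cast_sub hmk, Nat.cast_mul]
  set R : ℝ := ∑ k ∈ Icc 1 Y, ((N : ℝ) - m * k) * (g (m * k) - γb) with hR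
  have hsplit : ∑ k ∈ Icc 1 Y, ((N : ℝ) - m * k) * g (m * k) = γb * W + R := by
    rw [hW, hR, Finset.mul_sum, ← Finset.sum_add_distrib]
    exact Finset.sum_congr rfl fun k _ => by ring
  have hRle : |R| ≤ N * (2 * M * P) :=
    pmt_abs_sum_linearWeight_le (c := fun k => g (m * k) - γb) hP hcper hcsum hcB hmr.le hmY
  -- (c) the weight sum
  obtain ⟨hW1, hW2⟩ := pmt_weightSum_bounds (N := N) hm
  -- (d) assemble
  have hS : (∑ k ∈ Icc 1 Y, ∑ n ∈ Icc 1 (N - m * k), Λ n * Λ (n + m * k)) = γb * W + R + E := by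
    rw [hE, hcast, hsplit]
    ring
  have hN2 : (0 : ℝ) < (N : ℝ) ^ 2 := by positivity
  have hT : (m : ℝ) * pairMass N m / (N : ℝ) ^ 2 - γb =
      (-(γb * ((N : ℝ) ^ 2 - 2 * m * W)) + 2 * m * R + 2 * m * E) / (N : ℝ) ^ 2 := by
    rw [pairMass, ← hY, hS]
    field_simp
    ring
  rw [hT, abs_div, abs_of_pos hN2, div_le_iff₀ hN2]
  have hA1 : |-(γb * ((N : ℝ) ^ 2 - 2 * m * W))| ≤ M * (m * N) := by
    rw [abs_neg, abs_mul, abs_of_nonneg hW1]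
    exact mul_le_mul hγbM hW2 hW1 hM0
  have hA2 : |2 * (m : ℝ) * R| ≤ 2 * m * (N * (2 * M * P)) := by
    rw [abs_mul, abs_of_nonneg (by positivity)]
    exact mul_le_mul_of_nonneg_left hRle (by positivity)
  have hA3 : |2 * (m : ℝ) * E| ≤ 2 * m * (4 * ε * N * Y * ρ) := by
    rw [abs_mul, abs_of_nonneg (by positivity)]
    exact mul_le_mul_of_nonneg_left hEle (by positivity)
  have hB1 : M * (m * (N : ℝ)) ≤ M * P * m * N := by
    have : M * (m * (N : ℝ)) * 1 ≤ M * (m * (N : ℝ)) * P :=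
      mul_le_mul_of_nonneg_left hP1 (by positivity)
    linarith
  have hB2 : 8 * ε * ρ * N * ((m : ℝ) * Y) ≤ 8 * ε * ρ * N * N :=
    mul_le_mul_of_nonneg_left hmY (by positivity)
  have hrhs : (5 * M * P * m / N + 8 * ε * ρ) * (N : ℝ) ^ 2 = 5 * M * P * m * N + 8 * ε * ρ * N * N := by
    field_simp
  calc |(-(γb * ((N : ℝ) ^ 2 - 2 * m * W))) + 2 * m * R + 2 * m * E|
      ≤ |(-(γb * ((N : ℝ) ^ 2 - 2 * m * W)))| + |2 * (m : ℝ) * R| + |2 * (m : ℝ) * E| := by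
        refine (abs_add_le _ _).trans ?_
        gcongr
        exact abs_add_le _ _
    _ ≤ M * (m * N) + 2 * m * (N * (2 * M * P)) + 2 * m * (4 * ε * N * Y * ρ) :=
        add_le_add (add_le_add hA1 hA2) hA3
    _ ≤ 5 * M * P * m * N + 8 * ε * ρ * N * N := by linarith [hB1, hB2]
    _ = (5 * M * P * m / N + 8 * ε * ρ) * (N : ℝ) ^ 2 := hrhs.symm

/-! ### The registered stub -/

/-- **`stub_pairMassTransfer` (T).** `PairSumModel → PairMassTransfer`: given the model `g` of the pair sums at
conditioning `D` and accuracy `δ/16`, the sequences `k ↦ g(k m₁)` and `k ↦ g(k m₂)` COINCIDE (same prime divisors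
`p ≤ w = wlev D N`) and are periodic modulo the primorial `P` of `w`, bounded by `M = C(w + 1)`; by the
single-modulus estimate both normalised masses `m_i · pairMass N m_i/N²` are the common period mean up to
`5 M P m_i/N + (δ/2) m_i/φ(m_i)`, and `5 M P m_i ≤ 5 C · 16^w · N^{1/4} ≤ 5 C N^{3/4} ≤ (δ/2) N` once
`N ≥ (10 C/δ)^4` (`(w + 1) P ≤ 16^w`, `16^{2w} ≤ 4^{wD} ≤ N` for `D ≥ 4`). -/
theorem stub_pairMassTransfer : PairSumModel → PairMassTransfer := by
  rintro ⟨C, hC, hMdl⟩ D hD δ hδ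
  -- the model at conditioning `D` and accuracy `δ/16`
  obtain ⟨N₁, hN₁⟩ := hMdl D (by omega) (δ / 16) (by positivity)
  refine ⟨max N₁ (max ⌈(10 * C / δ) ^ 4⌉₊ 1), fun N hN m₁ m₂ hm₁ hm₂ hm₁N hm₂N hiff => ?_⟩
  have hN₁N : N₁ ≤ N := le_of_max_le_left hN
  have hN2 : ⌈(10 * C / δ) ^ 4⌉₊ ≤ N := le_of_max_le_left (le_of_max_le_right hN)
  have hN0 : 0 < N := le_of_max_le_right (le_of_max_le_right hN)
  have hNr : (0 : ℝ) < N := by exact_mod_cast hN0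
  obtain ⟨g, hginv, hgbd, hgapp⟩ := hN₁ N hN₁N
  -- `w`, the primorial `P` of `w`, the bound `M`
  set w : ℕ := wlev D N
  set P : ℕ := primorial w
  have hP : 0 < P := primorial_pos w
  set M : ℝ := C * ((w : ℝ) + 1) with hM
  -- `k ↦ g(mk)` is `P`-periodic (for every `m`) and bounded by `M`
  have hper : ∀ m k : ℕ, g (m * (k + P)) = g (m * k) := by
    intro m k
    refine hginv _ _ fun p hp hpw => ?_
    have hpP : p ∣ P := hp.dvd_primorial_iff.mpr hpw
    rw [hp.dvd_mul, hp.dvd_mul, Nat.dvd_add_left hpP]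
  have hbd : ∀ m k : ℕ, |g (m * k)| ≤ M := fun m k => hgbd (m * k)
  -- the two single-modulus estimates, with the SAME period mean
  have hε0 : (0 : ℝ) ≤ δ / 16 := by positivity
  have h1 := pmt_single_modulus (m := m₁) hN0 hm₁ hP hε0 (hper m₁) (hbd m₁) hgapp
  have h2 := pmt_single_modulus (m := m₂) hN0 hm₂ hP hε0 (hper m₂) (hbd m₂) hgapp
  have hmean : (∑ k ∈ Icc 1 P, g (m₁ * k)) / P = (∑ k ∈ Icc 1 P, g (m₂ * k)) / P := by
    congr 1
    refine Finset.sum_congr rfl fun k _ => hginv _ _ fun p hp hpw => ?_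
    rw [hp.dvd_mul, hp.dvd_mul, hiff p hp hpw]
  rw [hmean] at h1
  -- the `o(1)` term: `5 M P m/N ≤ δ/2` for `m ≤ N^{1/4}`
  have hsmall : ∀ m : ℕ, (m : ℝ) ≤ (N : ℝ) ^ (1 / 4 : ℝ) → 5 * M * P * m / N ≤ δ / 2 := by
    intro m hmN
    set X : ℝ := (N : ℝ) ^ (1 / 4 : ℝ) with hX
    have hX0 : 0 ≤ X := Real.rpow_nonneg hNr.le _
    have hX4 : X ^ 4 = (N : ℝ) := by
      rw [hX, show (1 / 4 : ℝ) = ((4 : ℕ) : ℝ)⁻¹ by norm_num]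
      exact Real.rpow_inv_natCast_pow hNr.le (by norm_num)
    -- `(w + 1) P ≤ 16^w` and `(16^w)^2 ≤ 4^{wD} ≤ N`
    have hQ : (w + 1) * P ≤ 4 ^ w * 4 ^ w :=
      Nat.mul_le_mul (Nat.succ_le_of_lt (Nat.lt_pow_self (by norm_num))) (primorial_le_four_pow w)
    have hQQ : (4 ^ w * 4 ^ w) * (4 ^ w * 4 ^ w) ≤ N := by
      calc (4 ^ w * 4 ^ w) * (4 ^ w * 4 ^ w) = 4 ^ (w * 4) := by ring
        _ ≤ 4 ^ (w * D) := Nat.pow_le_pow_right (by norm_num) (Nat.mul_le_mul_left w hD)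
        _ ≤ 4 ^ Nat.log 4 N :=
            Nat.pow_le_pow_right (by norm_num) (Nat.div_mul_le_self (Nat.log 4 N) D)
        _ ≤ N := Nat.pow_log_le_self 4 (by omega)
    set Q : ℕ := 4 ^ w * 4 ^ w
    have hQr : (Q : ℝ) ≤ X ^ 2 := by
      have h1 : (Q : ℝ) ^ 2 ≤ (X ^ 2) ^ 2 := by
        have h4 : (X ^ 2) ^ 2 = N := by rw [← pow_mul]; exact hX4
        rw [h4]
        exact_mod_cast (show Q ^ 2 ≤ N by rw [sq]; exact hQQ)
      exact (pow_le_pow_iff_left₀ (Nat.cast_nonneg Q) (by positivity) two_ne_zero).mp h1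
    have hMP : M * P ≤ C * Q := by
      have h1 : ((w : ℝ) + 1) * P ≤ Q := by exact_mod_cast hQ
      calc M * P = C * (((w : ℝ) + 1) * P) := by rw [hM]; ring
        _ ≤ C * Q := mul_le_mul_of_nonneg_left h1 hC.le
    -- `10 C/δ ≤ X`
    have hCX : 10 * C / δ ≤ X := by
      have h1 : (10 * C / δ) ^ 4 ≤ X ^ 4 := by
        rw [hX4]
        exact (Nat.le_ceil _).trans (by exact_mod_cast hN2)
      exact (pow_le_pow_iff_left₀ (by positivity) hX0 (by norm_num)).mp h1
    have hCX' : 5 * C ≤ δ / 2 * X := by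
      rw [div_le_iff₀ hδ] at hCX
      linarith
    rw [div_le_iff₀ hNr]
    calc 5 * M * P * m = 5 * (M * P) * m := by ring
      _ ≤ 5 * (C * Q) * X :=
          mul_le_mul (mul_le_mul_of_nonneg_left hMP (by norm_num)) hmN (Nat.cast_nonneg m) (by positivity)
      _ ≤ 5 * (C * X ^ 2) * X := by gcongr
      _ = (5 * C) * X ^ 3 := by ring
      _ ≤ (δ / 2 * X) * X ^ 3 := mul_le_mul_of_nonneg_right hCX' (by positivity)
      _ = δ / 2 * X ^ 4 := by ring
      _ = δ / 2 * N := by rw [hX4]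
  -- conclude
  have hδρ₁ : δ / 2 ≤ δ / 2 * ((m₁ : ℝ) / (Nat.totient m₁ : ℝ)) :=
    le_mul_of_one_le_right (by positivity) (pmt_one_le_div_totient hm₁)
  have hδρ₂ : δ / 2 ≤ δ / 2 * ((m₂ : ℝ) / (Nat.totient m₂ : ℝ)) :=
    le_mul_of_one_le_right (by positivity) (pmt_one_le_div_totient hm₂)
  have h2' : |(∑ k ∈ Icc 1 P, g (m₂ * k)) / P - (m₂ : ℝ) * pairMass N m₂ / (N : ℝ) ^ 2| ≤
      5 * M * P * m₂ / N + 8 * (δ / 16) * ((m₂ : ℝ) / (Nat.totient m₂ : ℝ)) := by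
    rw [abs_sub_comm]; exact h2
  linarith [abs_sub_le ((m₁ : ℝ) * pairMass N m₁ / (N : ℝ) ^ 2) ((∑ k ∈ Icc 1 P, g (m₂ * k)) / P)
    ((m₂ : ℝ) * pairMass N m₂ / (N : ℝ) ^ 2), hsmall m₁ hm₁N, hsmall m₂ hm₂N]

end Summit.Parity.GeneralizedHardyLittlewood.Cruxes.RelativeDimOne.FloatingLevelCore

end
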